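/-
Copyright (c) 2026 the pub-hodgecm-mathlib formalisation cell (harness21).  Prover seat hodgecm-mathlib-R90-CS-p03 (g0), Track B ∕ K2-LIT, h413 = `stmt-HodgeConjecture-24833`,
R90-TF section S8 «ContSpec-n½» (planner R90-CS-plan (g0), SOCKET-PLAN v1.1 B-iv «charLine transport along a unitary equivalence», the second transport paying S8B#6):
a file-independent support lemma for file B `R90_S8_ResidualSpectrumU3B`.
-/
import Literature.NumberTheory.Automorphic.AutomorphicCharacterLineUnique   -- ★ `closedSubrep_eq_lineSubrep_of_forall_apply_eq_smul` (multiplicity one for automorphic characters); brings ★ `AutomorphicCharacterLine` (`lineSubrep`, `lineSubrep_toContRep_apply`) and ★ `HilbertRepSpectrum` (`ClosedSubrep`, `AreUnitarilyEquivalent`)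
import HarnessLib

/-!
# S8 support — `R90S8CharLineOfEquiv`: a closed subrepresentation of `L²` equivalent to the line of an automorphic character IS that line

Track B ∕ K2-LIT, crux h413 = `stmt-HodgeConjecture-24833`, route of record `HCCMUnconditional`; cell `hodgecm-mathlib`, R90-TF programme, section S8
«ContSpec-n½» (§13.9 residual spectrum of `U(3)`), support lemma «charLine transport along a unitary equivalence» of the S8 socket plan v1.1 (B-iv): together
with S8B#7 (★ `isOrtho_or_equiv_of_isTopIrreducible`, the unitary Schur dichotomy), S8B#7b (★ `le_left_of_isOrtho_right`) and the `IsPiN` transport S8B#9 it pays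
S8B#6 `sock_S8_res_cuspidal_of_not_piN` from the classification S8B#2.  THEOREMS ONLY (no `def`, no `instance`, no `notation`, no named-fact hypothesis, no
`sorry`; default heartbeats); lane `--supports stmt-HodgeConjecture-24833 --as helper` (count-neutral).  GENERIC: any adelic datum `𝒢` with `G(𝔸_K)` locally compact
second countable, any automorphic measure `μ`, any unitary automorphic character `ψ`.

THE MATHEMATICS ([Gelbart1975] §2.A and the proof of Thm. 10.10, p. 158; [Dixmier1977] §13.1.3 for equivalences).  Let `ℓ = ℂ [ψ̄] ≤ L²(G(K)\G(𝔸_K), μ)` be the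
line of the unitary automorphic character `ψ` (★ `AutomorphicCharacter.lineSubrep`); `G(𝔸_K)` acts on `ℓ` by the scalars `ψ(g)⁻¹` (★ `lineSubrep_toContRep_apply`).
If a closed invariant subspace `W ≤ L²` is equivalent to `ℓ` AS AN ABSTRACT REPRESENTATION — a continuous linear `G(𝔸_K)`-isomorphism `e : W ≅ ℓ`, isometric or
not — then for `v ∈ W`, `e (R(g) v) = R(g) (e v) = ψ(g)⁻¹ e v = e (ψ(g)⁻¹ v)`, so `R(g) v = ψ(g)⁻¹ v`: `W` is a (non-zero) `ψ⁻¹`-eigenspace of the regular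
representation, hence `W = ℓ` by MULTIPLICITY ONE FOR AUTOMORPHIC CHARACTERS (★ `closedSubrep_eq_lineSubrep_of_forall_apply_eq_smul`: two `L²`
eigenfunctions of the same character have a.e. constant ratio by ergodicity).  In particular a closed subrepresentation UNITARILY equivalent to `ℓ`
(★ `ContRepresentation.AreUnitarilyEquivalent`, the output of the unitary Schur dichotomy S8B#7) equals `ℓ` — so an irreducible summand of `L²_disc` whose copy
inside `L²_res` is a character line `ψ∘det` is itself that character line.
* §1 `toContRep_apply_eq_smul_of_equiv` — the scalar action transports along an equivalence (engine);
* §2 **`eq_lineSubrep_of_equiv`** ∕ **`eq_lineSubrep_of_areUnitarilyEquivalent`** — THE HEAD (topological ∕ unitary form);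
* §3 `discreteAutomorphicRep_eq_ofChar_of_areUnitarilyEquivalent` — the same for ★ `DiscreteAutomorphicRep` (`P = ofChar ψ μ`).
HONEST LABEL: HC_CM is proved only modulo the 7 printed citations (2 remaining named inputs: hLiu418 = `stmt-HodgeConjecture-24832`, h413 = `stmt-HodgeConjecture-24833`) until
rung 0 closes; this file asserts no named fact and closes no socket; count-neutral.

## References
* [Gelbart1975] S. Gelbart, *Automorphic forms on adele groups*, Ann. of Math. Stud. 83 (1975), §2.A; Thm. 10.10 (proof, p. 158).
* [Dixmier1977] J. Dixmier, *C\*-algebras* (North-Holland, 1977), §13.1.3 (equivalent representations).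
-/

set_option autoImplicit false
set_option linter.dupNamespace false  -- the mandated namespace `…HodgeConjecture.HodgeConjecture.R90.S8` (LEAD #1 L1) repeats the summit's segment

noncomputable section

open MeasureTheory NumberField
open Literature.NumberTheory.Automorphic

namespace Summit.HodgeConjecture.HodgeConjecture.R90.S8

open ContRepresentation

universe u

variable {K : Type} [Field K] [NumberField K] {𝒢 : AdelicGroupData.{u} K}
  (ψ : 𝒢.AutomorphicCharacter) (μ : Measure 𝒢.automorphicQuotient) [𝒢.IsAutomorphicMeasure μ]

/-! ## §1 Engine: the scalar action `ψ(g)⁻¹` transports along an equivalence with the line -/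

/-- **A closed subrepresentation of `L²` equivalent to the line `ℂ [ψ̄]` is a `ψ⁻¹`-eigenspace of the regular representation**: if `e : W ≅ ℂ [ψ̄]` is a
continuous linear `G(𝔸_K)`-isomorphism then `R(g) v = ψ(g)⁻¹ v` for every `v ∈ W` (apply `e`, use that `G(𝔸_K)` acts on the line by `ψ(g)⁻¹`, ★
`lineSubrep_toContRep_apply`, and cancel `e`). [cite: Gelbart1975, §2.A] [cite: Dixmier1977, §13.1.3] -/
theorem toContRep_apply_eq_smul_of_equiv (W : ClosedSubrep (𝒢.rightRegular μ))
    (e : W.toContRep.Equiv (ψ.lineSubrep μ).toContRep) (g : 𝒢.Adelic) (v : W.toSubmodule) :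
    W.toContRep g v = ((ψ g : ℂˣ) : ℂ)⁻¹ • v := by
  apply e.toContinuousLinearEquiv.injective
  have h1 : e.toContIntertwiningMap (W.toContRep g v) = (ψ.lineSubrep μ).toContRep g (e.toContIntertwiningMap v) :=
    e.toContIntertwiningMap.isIntertwining g v
  rw [ψ.lineSubrep_toContRep_apply μ g] at h1
  rw [e.toContinuousLinearEquiv_apply, e.toContinuousLinearEquiv_apply, h1, map_smul]

/-! ## §2 The head: a closed subrepresentation equivalent to a character line is that line -/

variable [LocallyCompactSpace 𝒢.Adelic] [SecondCountableTopology 𝒢.Adelic]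

/-- **A closed subrepresentation of `L²(G(K)\G(𝔸_K), μ)` equivalent, as an abstract representation, to the line `ℂ [ψ̄]` of a unitary automorphic
character `ψ` IS that line** (topological form: any continuous linear `G(𝔸_K)`-isomorphism).  By §1, `W` is a `ψ⁻¹`-eigenspace; it is non-zero (isomorphic
to a line); multiplicity one for automorphic characters (★ `closedSubrep_eq_lineSubrep_of_forall_apply_eq_smul`) concludes.
[cite: Gelbart1975, Thm. 10.10 (proof, p. 158)] [cite: Dixmier1977, §13.1.3] -/
theorem eq_lineSubrep_of_equiv (W : ClosedSubrep (𝒢.rightRegular μ))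
    (e : W.toContRep.Equiv (ψ.lineSubrep μ).toContRep) : W = ψ.lineSubrep μ := by
  have hnt : Nontrivial W.toSubmodule := by
    haveI : Nontrivial (ψ.lineSubrep μ).toSubmodule :=
      Module.nontrivial_of_finrank_eq_succ (n := 0) (ψ.finrank_lineSubrep μ)
    exact e.toContinuousLinearEquiv.toEquiv.nontrivial
  exact ψ.closedSubrep_eq_lineSubrep_of_forall_apply_eq_smul μ (toContRep_apply_eq_smul_of_equiv ψ μ W e) hnt

/-- **A closed subrepresentation of `L²(G(K)\G(𝔸_K), μ)` UNITARILY equivalent to the line `ℂ [ψ̄]` of a unitary automorphic character `ψ` IS that line**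
(★ `ContRepresentation.AreUnitarilyEquivalent` — the shape produced by the unitary Schur dichotomy S8B#7; the isometry is not used).  Consumer (file B, S8B#6):
an irreducible summand `P` of `L²_disc(U(3))` whose equivalent copy inside `L²_res` is a character line `ψ∘det` equals that line.
[cite: Gelbart1975, Thm. 10.10 (proof, p. 158)] [cite: Dixmier1977, §13.1.3] -/
theorem eq_lineSubrep_of_areUnitarilyEquivalent (W : ClosedSubrep (𝒢.rightRegular μ))
    (h : AreUnitarilyEquivalent W.toContRep (ψ.lineSubrep μ).toContRep) : W = ψ.lineSubrep μ := by
  obtain ⟨e, -⟩ := h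
  exact eq_lineSubrep_of_equiv ψ μ W e

/-! ## §3 The same for discrete automorphic representations -/

/-- **A discrete automorphic representation unitarily equivalent to the line of `ψ` IS `ofChar ψ μ`** (★ `DiscreteAutomorphicRep.ofChar`): its space is the
line by §2, and a discrete automorphic representation is determined by its space. [cite: Gelbart1975, Thm. 10.10 (proof, p. 158)] [cite: Dixmier1977, §13.1.3] -/
theorem discreteAutomorphicRep_eq_ofChar_of_areUnitarilyEquivalent (P : DiscreteAutomorphicRep 𝒢 μ)
    (h : AreUnitarilyEquivalent P.space.toContRep (ψ.lineSubrep μ).toContRep) : P = DiscreteAutomorphicRep.ofChar ψ μ := by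
  have hsp : P.space = (DiscreteAutomorphicRep.ofChar ψ μ).space :=
    (eq_lineSubrep_of_areUnitarilyEquivalent ψ μ P.space h).trans (DiscreteAutomorphicRep.ofChar_space ψ μ).symm
  cases P
  cases hsp
  rfl

end Summit.HodgeConjecture.HodgeConjecture.R90.S8

end
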